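import Literature.Geometry.Symplectic.JPlanePencilMemberCap
import HarnessLib

/-!
# The family parameter of a local pencil family is positively oriented at far points

Support theorems (no named facts, D-0026) for
`Literature.Geometry.Symplectic.jPlanePencil_localFamily_homotopySphere`
(`JPlanePencilLocalFamily.lean`; C. Wendl, *Holomorphic Curves in Low Dimensions* (2018),
Prop. 2.53 with `m = 1`, for homotopy 4-spheres).

This file discharges hypothesis `hS` of `IsPencilPlane.eq_of_localFamily`
(`JPlanePencilUniversality.lean`) from the smoothness of the family ACROSS the constraint point
(Wendl, proof of Prop. 2.53: the constrained family is a smooth 2-parameter family of embedded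
spheres in the blown-up compactification `X̂`, through the point `q_a` of the exceptional
sphere; in the tree's coordinates `(x', w) = (1/z, w)` near `q_a` this is joint smoothness of
`(b', η) ↦ (capX p (Floc b') η, famW p Floc (b', η))` at `η = 0`).

* §1 Wirtinger algebra: an `ℝ`-linear `T : ℂ → ℂ²` is `c ↦ c T⁺ + c̄ T⁻`; if a complex normal
  functional `n` with `n ℓ = 0` has `|n T⁻| < |n T⁺|`, then every solution `(c, v)` of
  `T c + v ℓ = i T 1` has `Im c > 0` (`im_pos_of_wirtinger_criterion`).
* §2 The family in the coordinates at infinity: `famW`, the representation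
  `pencilCoord ∘ Φ = G ∘ (capX, famW) ∘ (id × inv)` with `G (X, W) = (X⁻¹, W)`, its derivative,
  and the values of the derivative of `(capX, famW)` on the exceptional line `η = 0`.
* §3 `IsPencilPlane.familyOrientation_of_smoothCompactification`: the hypothesis `hS`.

## References

* C. Wendl, *Holomorphic Curves in Low Dimensions*, LNM 2216, Springer (2018), Prop. 2.53,
  Thm. 2.46. [Wendl2018]
-/

noncomputable section

open scoped Manifold ContDiff Topology ComplexConjugate
open Set Function Filter Metric Complex

namespace Literature.Geometry.Symplectic

/-! ### §1 Wirtinger algebra -/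

section Wirtinger

/-- The complex-linear part `T⁺ = (T 1 − i T i)/2` of an `ℝ`-linear `T : ℂ → ℂ²`. [folklore] -/
def wirtPlus (T : ℂ →L[ℝ] ℂ × ℂ) : ℂ × ℂ := (2⁻¹ : ℂ) • (T 1 - Complex.I • T Complex.I)

/-- The anti-linear part `T⁻ = (T 1 + i T i)/2` of an `ℝ`-linear `T : ℂ → ℂ²`. [folklore] -/
def wirtMinus (T : ℂ →L[ℝ] ℂ × ℂ) : ℂ × ℂ := (2⁻¹ : ℂ) • (T 1 + Complex.I • T Complex.I)

/-- Key identity behind the Wirtinger decomposition, in real coordinates. [folklore] -/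
theorem wirt_key (T : ℂ →L[ℝ] ℂ × ℂ) (x y : ℝ) :
    ((x : ℂ) + y * Complex.I) • wirtPlus T + ((x : ℂ) - y * Complex.I) • wirtMinus T =
      (x : ℝ) • T 1 + (y : ℝ) • T Complex.I := by
  ext1
  · simp only [wirtPlus, wirtMinus, Prod.fst_add, Prod.smul_fst, Prod.fst_sub, smul_eq_mul,
      Complex.real_smul]
    ring_nf
    rw [Complex.I_sq]
    ring
  · simp only [wirtPlus, wirtMinus, Prod.snd_add, Prod.smul_snd, Prod.snd_sub, smul_eq_mul,
      Complex.real_smul]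
    ring_nf
    rw [Complex.I_sq]
    ring

/-- `T c = c T⁺ + c̄ T⁻`. [folklore] -/
theorem apply_eq_wirt (T : ℂ →L[ℝ] ℂ × ℂ) (c : ℂ) :
    T c = c • wirtPlus T + conj c • wirtMinus T := by
  have h : T c = (c.re : ℝ) • T 1 + (c.im : ℝ) • T Complex.I := by
    conv_lhs => rw [← Complex.re_add_im c]
    rw [map_add]
    have h1 : T (c.re : ℂ) = (c.re : ℝ) • T 1 := by
      rw [← T.map_smul]; congr 1; simp
    have h2 : T ((c.im : ℂ) * Complex.I) = (c.im : ℝ) • T Complex.I := by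
      rw [← T.map_smul]; congr 1
    rw [h1, h2]
  have hc : (c.re : ℂ) + c.im * Complex.I = c := Complex.re_add_im c
  have hcc : (c.re : ℂ) - c.im * Complex.I = conj c := by
    apply Complex.ext <;> simp
  rw [h, ← wirt_key T c.re c.im, hc, hcc]

/-- `T 1 = T⁺ + T⁻`. [folklore] -/
theorem apply_one_eq_wirt (T : ℂ →L[ℝ] ℂ × ℂ) : T 1 = wirtPlus T + wirtMinus T := by
  have := apply_eq_wirt T 1
  simpa using this

/-- The complex normal functional `n_ℓ (V) = V₂ ℓ₁ − V₁ ℓ₂` (vanishing on `ℂ ℓ`). [folklore] -/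
def nrmFun (ℓ V : ℂ × ℂ) : ℂ := V.2 * ℓ.1 - V.1 * ℓ.2

/-- `n_ℓ` is additive. [folklore] -/
theorem nrmFun_add (ℓ V W : ℂ × ℂ) : nrmFun ℓ (V + W) = nrmFun ℓ V + nrmFun ℓ W := by
  simp only [nrmFun, Prod.fst_add, Prod.snd_add]; ring

/-- `n_ℓ` is complex-homogeneous. [folklore] -/
theorem nrmFun_smul (ℓ V : ℂ × ℂ) (c : ℂ) : nrmFun ℓ (c • V) = c * nrmFun ℓ V := by
  simp only [nrmFun, Prod.smul_fst, Prod.smul_snd, smul_eq_mul]; ring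

/-- `n_ℓ (ℓ) = 0`. [folklore] -/
theorem nrmFun_self (ℓ : ℂ × ℂ) : nrmFun ℓ ℓ = 0 := by
  simp only [nrmFun]; ring

/-- **The orientation criterion.** If `|n_ℓ T⁻| < |n_ℓ T⁺|` then every solution `(c, v)` of
`T c + v ℓ = i · T 1` has `Im c > 0`: applying `n_ℓ` gives `(c − i) P = (i − c̄) Q` with
`P = n_ℓ T⁺`, `Q = n_ℓ T⁻`, so `|c − i| |P| = |c + i| |Q|`, forcing `|c − i| < |c + i|`.
[folklore] -/
theorem im_pos_of_wirtinger_criterion (T : ℂ →L[ℝ] ℂ × ℂ) (ℓ : ℂ × ℂ) {c v : ℂ}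
    (hlt : ‖nrmFun ℓ (wirtMinus T)‖ < ‖nrmFun ℓ (wirtPlus T)‖)
    (hEq : T c + v • ℓ = Complex.I • T 1) : 0 < c.im := by
  set P := nrmFun ℓ (wirtPlus T) with hP
  set Q := nrmFun ℓ (wirtMinus T) with hQ
  have h1 : c * P + conj c * Q = Complex.I * (P + Q) := by
    have h := congrArg (nrmFun ℓ) hEq
    rw [nrmFun_add, nrmFun_smul, nrmFun_self, mul_zero, add_zero, apply_eq_wirt, nrmFun_add,
      nrmFun_smul, nrmFun_smul, nrmFun_smul, apply_one_eq_wirt, nrmFun_add] at h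
    exact h
  have h2 : (c - Complex.I) * P = (Complex.I - conj c) * Q := by linear_combination h1
  have hnorm : ‖c - Complex.I‖ * ‖P‖ = ‖c + Complex.I‖ * ‖Q‖ := by
    have := congrArg (fun z : ℂ => ‖z‖) h2
    simp only [norm_mul] at this
    rw [this]
    congr 1
    have : Complex.I - conj c = conj (-(c + Complex.I)) := by
      simp [map_add, map_neg, Complex.conj_I]; ring
    rw [this, Complex.norm_conj, norm_neg]
  by_contra hle
  push Not at hle
  -- `Im c ≤ 0` gives `|c + i| ≤ |c − i|`
  have hcmp : ‖c + Complex.I‖ ≤ ‖c - Complex.I‖ := by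
    rw [← Real.sqrt_sq (norm_nonneg (c + Complex.I)), ← Real.sqrt_sq (norm_nonneg (c - Complex.I))]
    apply Real.sqrt_le_sqrt
    rw [← Complex.normSq_eq_norm_sq, ← Complex.normSq_eq_norm_sq, Complex.normSq_apply,
      Complex.normSq_apply]
    simp only [Complex.add_re, Complex.I_re, add_zero, Complex.add_im, Complex.I_im,
      Complex.sub_re, sub_zero, Complex.sub_im]
    nlinarith
  have hPpos : 0 < ‖P‖ := lt_of_le_of_lt (norm_nonneg _) hlt
  by_cases hci : c + Complex.I = 0
  · have hc : c = -Complex.I := eq_neg_of_add_eq_zero_left hci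
    rw [hc] at hnorm
    have : ‖-Complex.I - Complex.I‖ = 2 := by
      rw [show -Complex.I - Complex.I = -(2 * Complex.I) by ring, norm_neg, norm_mul,
        Complex.norm_I, mul_one]
      norm_num
    rw [this, neg_add_cancel, norm_zero, zero_mul] at hnorm
    linarith
  · have hcipos : 0 < ‖c + Complex.I‖ := norm_pos_iff.2 hci
    -- `|c+i| |P| ≤ |c−i| |P| = |c+i| |Q|`, so `|P| ≤ |Q|`
    have h3 : ‖c + Complex.I‖ * ‖P‖ ≤ ‖c + Complex.I‖ * ‖Q‖ := by
      rw [← hnorm]; exact mul_le_mul_of_nonneg_right hcmp (norm_nonneg _)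
    have h4 : ‖P‖ ≤ ‖Q‖ := le_of_mul_le_mul_left h3 hcipos
    linarith

end Wirtinger

/-! ### §2 The family in the coordinates at infinity -/

section AtInfinity

variable {M : Type} [TopologicalSpace M] [T2Space M] [CompactSpace M]
  [ChartedSpace (EuclideanSpace ℝ (Fin 4)) M] [IsManifold (𝓡 4) ∞ M]
  {p : M} {J : ∀ x : punctured p, TangentSpace (𝓡 4) x →L[ℝ] TangentSpace (𝓡 4) x} {ε : ℝ}

open Classical in
/-- The `w`-coordinate of the family at infinity: `famW (b', η) = w (Floc b' η⁻¹)` for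
`η ≠ 0` and `= b'` (the intercept) at `η = 0`. [cite: Wendl2018, Prop. 2.53 (proof, p. 65)] -/
def famW (p : M) (Floc : ℂ → ℂ → punctured p) (q : ℂ × ℂ) : ℂ :=
  if q.2 = 0 then q.1 else (pencilCoord p (Floc q.1 q.2⁻¹)).2

/-- The family in the blow-up coordinates `(x', w) = (1/z, w)` at infinity:
`famXW (b', η) = (capX p (Floc b') η, famW p Floc (b', η))`. [cite: Wendl2018, Prop. 2.53] -/
def famXW (p : M) (Floc : ℂ → ℂ → punctured p) (q : ℂ × ℂ) : ℂ × ℂ :=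
  (capX p (Floc q.1) q.2, famW p Floc q)

omit [CompactSpace M] [IsManifold (𝓡 4) ∞ M] in
/-- On the exceptional line: `famXW (b', 0) = (0, b')`. [folklore] -/
@[simp] theorem famXW_zero (Floc : ℂ → ℂ → punctured p) (b' : ℂ) :
    famXW p Floc (b', 0) = (0, b') := by
  simp [famXW, famW]

omit [CompactSpace M] [IsManifold (𝓡 4) ∞ M] in
/-- Off the exceptional line: `famXW (b', η) = (z⁻¹, w)` at `Floc b' η⁻¹`. [folklore] -/
theorem famXW_of_ne_zero (Floc : ℂ → ℂ → punctured p) {b' η : ℂ} (hη : η ≠ 0) :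
    famXW p Floc (b', η) =
      (((pencilCoord p (Floc b' η⁻¹)).1)⁻¹, (pencilCoord p (Floc b' η⁻¹)).2) := by
  simp [famXW, famW, capX_of_ne_zero hη, hη]

/-- The blow-down map `G (X, W) = (X⁻¹, W)`. [folklore] -/
def blowDown (q : ℂ × ℂ) : ℂ × ℂ := (q.1⁻¹, q.2)

/-- The derivative of `G` at a point with first coordinate `X ≠ 0`: `(a, c) ↦ (−a/X², c)`.
[folklore] -/
def blowDownDeriv (X : ℂ) : ℂ × ℂ →L[ℝ] ℂ × ℂ :=
  ((-(X ^ 2)⁻¹ : ℂ) • ContinuousLinearMap.fst ℝ ℂ ℂ).prod (ContinuousLinearMap.snd ℝ ℂ ℂ)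

/-- Pointwise formula for `blowDownDeriv`. [folklore] -/
@[simp] theorem blowDownDeriv_apply (X : ℂ) (v : ℂ × ℂ) :
    blowDownDeriv X v = (-(X ^ 2)⁻¹ * v.1, v.2) := rfl

/-- `blowDownDeriv` is complex-linear. [folklore] -/
theorem blowDownDeriv_smul (X c : ℂ) (v : ℂ × ℂ) :
    blowDownDeriv X (c • v) = c • blowDownDeriv X v := by
  ext1 <;> simp [mul_left_comm]

/-- `G` is differentiable off `{X = 0}` with derivative `blowDownDeriv`. [folklore] -/
theorem hasFDerivAt_blowDown {q : ℂ × ℂ} (hq : q.1 ≠ 0) :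
    HasFDerivAt blowDown (blowDownDeriv q.1) q := by
  have hi : HasFDerivAt ((fun x : ℂ => x⁻¹) ∘ (Prod.fst : ℂ × ℂ → ℂ))
      ((ContinuousLinearMap.restrictScalars ℝ
        (ContinuousLinearMap.smulRight (1 : ℂ →L[ℂ] ℂ) (-(q.1 ^ 2)⁻¹))).comp
        (ContinuousLinearMap.fst ℝ ℂ ℂ)) q :=
    ((hasFDerivAt_inv hq).restrictScalars ℝ).comp q hasFDerivAt_fst
  have hF : (ContinuousLinearMap.restrictScalars ℝ
        (ContinuousLinearMap.smulRight (1 : ℂ →L[ℂ] ℂ) (-(q.1 ^ 2)⁻¹))).comp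
        (ContinuousLinearMap.fst ℝ ℂ ℂ) = (-(q.1 ^ 2)⁻¹ : ℂ) • ContinuousLinearMap.fst ℝ ℂ ℂ := by
    ext v <;> simp [mul_comm]
  have h1 : HasFDerivAt (fun q : ℂ × ℂ => q.1⁻¹)
      ((-(q.1 ^ 2)⁻¹ : ℂ) • ContinuousLinearMap.fst ℝ ℂ ℂ) q := hF ▸ hi
  exact h1.prodMk hasFDerivAt_snd

omit [CompactSpace M] [IsManifold (𝓡 4) ∞ M] in
/-- **The representation at infinity**: `pencilCoord (Floc b' ξ) = G (famXW (b', ξ⁻¹))` for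
`ξ ≠ 0`. [cite: Wendl2018, Prop. 2.53 (proof, p. 65)] -/
theorem pencilCoord_eq_blowDown_famXW (Floc : ℂ → ℂ → punctured p) {b' ξ : ℂ} (hξ : ξ ≠ 0) :
    pencilCoord p (Floc b' ξ) = blowDown (famXW p Floc (b', ξ⁻¹)) := by
  rw [famXW_of_ne_zero Floc (inv_ne_zero hξ), inv_inv, blowDown]
  simp

omit [CompactSpace M] in
/-- **The derivative of `pencilCoord ∘ Φ` through the manifold**: at a point `q₀` with
`Φ q₀` in the standard chart ball it is `flatCx ∘ D_{Φ q₀} ∘ dΦ_{q₀}`. [folklore] -/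
theorem hasFDerivAt_pencilCoord_comp_family {Φ : ℂ × ℂ → punctured p} {q₀ : ℂ × ℂ}
    (hΦ : ContMDiffAt 𝓘(ℝ, ℂ × ℂ) (𝓡 4) ∞ Φ q₀) (hx : InPuncturedChartBall p ε (Φ q₀)) :
    HasFDerivAt (fun q => pencilCoord p (Φ q))
      (((flatCx : EuclideanSpace ℝ (Fin 4) →L[ℝ] ℂ × ℂ).comp
        ((fderiv ℝ inversion (extChartAt (𝓡 4) p (Φ q₀).1 - extChartAt (𝓡 4) p p)).comp
          (mfderiv (𝓡 4) 𝓘(ℝ, EuclideanSpace ℝ (Fin 4))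
            (fun z : punctured p => extChartAt (𝓡 4) p z.1) (Φ q₀)))).comp
        (mfderiv 𝓘(ℝ, ℂ × ℂ) (𝓡 4) Φ q₀)) q₀ := by
  have hΦ' : HasMFDerivAt 𝓘(ℝ, ℂ × ℂ) (𝓡 4) Φ q₀ (mfderiv 𝓘(ℝ, ℂ × ℂ) (𝓡 4) Φ q₀) :=
    (hΦ.mdifferentiableAt (by simp)).hasMFDerivAt
  have hpc : HasMFDerivAt (𝓡 4) 𝓘(ℝ, ℂ × ℂ) (pencilCoord p) (Φ q₀)
      ((flatCx : EuclideanSpace ℝ (Fin 4) →L[ℝ] ℂ × ℂ).comp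
        ((fderiv ℝ inversion (extChartAt (𝓡 4) p (Φ q₀).1 - extChartAt (𝓡 4) p p)).comp
          (mfderiv (𝓡 4) 𝓘(ℝ, EuclideanSpace ℝ (Fin 4))
            (fun z : punctured p => extChartAt (𝓡 4) p z.1) (Φ q₀)))) := by
    have h1 := hasMFDerivAt_flatCoord p hx
    have h2 : HasMFDerivAt 𝓘(ℝ, EuclideanSpace ℝ (Fin 4)) 𝓘(ℝ, ℂ × ℂ)
        (flatCx : EuclideanSpace ℝ (Fin 4) → ℂ × ℂ)
        (inversion (extChartAt (𝓡 4) p (Φ q₀).1 - extChartAt (𝓡 4) p p))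
        (flatCx : EuclideanSpace ℝ (Fin 4) →L[ℝ] ℂ × ℂ) :=
      (flatCx : EuclideanSpace ℝ (Fin 4) →L[ℝ] ℂ × ℂ).hasFDerivAt.hasMFDerivAt
    have h3 := h2.comp (Φ q₀) h1
    have heq : (pencilCoord p : punctured p → ℂ × ℂ) =
        (flatCx : EuclideanSpace ℝ (Fin 4) → ℂ × ℂ) ∘
          fun z : punctured p => inversion (extChartAt (𝓡 4) p z.1 - extChartAt (𝓡 4) p p) := by
      funext x; exact pencilCoord_eq_flatCx p x
    rw [heq]
    exact h3
  exact (hpc.comp q₀ hΦ').hasFDerivAt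

/-- `wirtPlus` commutes with post-composition by the complex-linear `blowDownDeriv`. [folklore] -/
theorem wirtPlus_blowDownDeriv_comp (X : ℂ) (S : ℂ →L[ℝ] ℂ × ℂ) :
    wirtPlus ((blowDownDeriv X).comp S) = blowDownDeriv X (wirtPlus S) := by
  simp only [wirtPlus, ContinuousLinearMap.comp_apply, blowDownDeriv_smul, map_sub]

/-- `wirtMinus` commutes with post-composition by the complex-linear `blowDownDeriv`. [folklore] -/
theorem wirtMinus_blowDownDeriv_comp (X : ℂ) (S : ℂ →L[ℝ] ℂ × ℂ) :
    wirtMinus ((blowDownDeriv X).comp S) = blowDownDeriv X (wirtMinus S) := by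
  simp only [wirtMinus, ContinuousLinearMap.comp_apply, blowDownDeriv_smul, map_add]

/-- The normal functional after blow-down: a common factor `−X⁻²`. [folklore] -/
theorem nrmFun_blowDownDeriv (X : ℂ) (m A : ℂ × ℂ) :
    nrmFun (blowDownDeriv X m) (blowDownDeriv X A) =
      (-(X ^ 2)⁻¹) * (A.2 * m.1 - A.1 * m.2) := by
  simp only [nrmFun, blowDownDeriv_apply]; ring

end AtInfinity

/-! ### §3 The orientation of the family parameter at far points -/

section Orientation

variable {M : Type} [TopologicalSpace M] [T2Space M] [CompactSpace M]
  [ChartedSpace (EuclideanSpace ℝ (Fin 4)) M] [IsManifold (𝓡 4) ∞ M]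
  {p : M} {J : ∀ x : punctured p, TangentSpace (𝓡 4) x →L[ℝ] TangentSpace (𝓡 4) x} {ε : ℝ}

/-- Elementary estimate for the criterion: if `A⁺` is `d`-close to `(0, 1)`, `A⁻` is `d`-close
to `0`, `μ` is `d`-close to `(u, β)` with `‖u‖ = 1`, `‖μ‖ ≤ K` and `d (4K + 1) < 1`, then
`|A⁻₂ μ₁ − A⁻₁ μ₂| < |A⁺₂ μ₁ − A⁺₁ μ₂|`. [folklore] -/
theorem criterion_estimate {Ap Am μ : ℂ × ℂ} {u β : ℂ} {d K : ℝ}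
    (hAp : ‖Ap - (0, 1)‖ ≤ d) (hAm : ‖Am‖ ≤ d) (hμ : ‖μ - (u, β)‖ ≤ d) (hu : ‖u‖ = 1)
    (hμK : ‖μ‖ ≤ K) (hd : d * (4 * K + 1) < 1) :
    ‖Am.2 * μ.1 - Am.1 * μ.2‖ < ‖Ap.2 * μ.1 - Ap.1 * μ.2‖ := by
  have hd0 : 0 ≤ d := le_trans (norm_nonneg _) hAm
  have hμ1 : ‖μ.1‖ ≤ K := (norm_fst_le μ).trans hμK
  have hμ2 : ‖μ.2‖ ≤ K := (norm_snd_le μ).trans hμK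
  have hAm1 : ‖Am.1‖ ≤ d := (norm_fst_le Am).trans hAm
  have hAm2 : ‖Am.2‖ ≤ d := (norm_snd_le Am).trans hAm
  have hAp1 : ‖Ap.1‖ ≤ d := by
    have := norm_fst_le (Ap - (0, 1)); simp only [Prod.fst_sub, sub_zero] at this
    exact this.trans hAp
  have hAp2 : ‖Ap.2 - 1‖ ≤ d := by
    have := norm_snd_le (Ap - (0, 1)); simp only [Prod.snd_sub] at this
    exact this.trans hAp
  have hμ1u : ‖μ.1 - u‖ ≤ d := by
    have := norm_fst_le (μ - (u, β)); simp only [Prod.fst_sub] at this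
    exact this.trans hμ
  -- lower bound for the `+` term
  have hlow : 1 - d * (2 * K + 1) ≤ ‖Ap.2 * μ.1 - Ap.1 * μ.2‖ := by
    have hdecomp : Ap.2 * μ.1 - Ap.1 * μ.2 = u + ((Ap.2 - 1) * μ.1 + (μ.1 - u) - Ap.1 * μ.2) := by
      ring
    rw [hdecomp]
    have h1 : ‖(Ap.2 - 1) * μ.1 + (μ.1 - u) - Ap.1 * μ.2‖ ≤ d * K + d + d * K := by
      refine (norm_sub_le _ _).trans (add_le_add ((norm_add_le _ _).trans (add_le_add ?_ hμ1u)) ?_)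
      · rw [norm_mul]; exact mul_le_mul hAp2 hμ1 (norm_nonneg _) hd0
      · rw [norm_mul]; exact mul_le_mul hAp1 hμ2 (norm_nonneg _) hd0
    have h2 := norm_sub_norm_le u (-( (Ap.2 - 1) * μ.1 + (μ.1 - u) - Ap.1 * μ.2))
    rw [sub_neg_eq_add, norm_neg, hu] at h2
    linarith
  -- upper bound for the `−` term
  have hup : ‖Am.2 * μ.1 - Am.1 * μ.2‖ ≤ 2 * d * K := by
    refine (norm_sub_le _ _).trans ?_
    rw [norm_mul, norm_mul]
    have h1 : ‖Am.2‖ * ‖μ.1‖ ≤ d * K := mul_le_mul hAm2 hμ1 (norm_nonneg _) hd0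
    have h2 : ‖Am.1‖ * ‖μ.2‖ ≤ d * K := mul_le_mul hAm1 hμ2 (norm_nonneg _) hd0
    linarith
  nlinarith

/-- **The family parameter is positively oriented at far points** (hypothesis `hS` of
`IsPencilPlane.eq_of_localFamily`). If the family `(b', η) ↦ famXW (b', η)` is `C^∞` about
`(b, 0)` (smoothness of the constrained family across the exceptional sphere of the blow-up),
then at all far points of the central member `Floc b` every solution `(c, v)` of
`dΦ (c, v) = J dΦ (1, 0)` has `Im c > 0`: through `pencilCoord = G ∘ famXW ∘ (id × inv)` the
equation reads `T c + v ℓ = i T 1` with `T = dG ∘ ∂_{b'} famXW`, `ℓ = dG (∂_η famXW (−η²))`, and as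
`η → 0` one has `∂_{b'} famXW → (0, id)`, `∂_{b̄'} famXW → 0`, `∂_η capX → 1`, so the Wirtinger
criterion of §1 applies. [cite: Wendl2018, Prop. 2.53 with Thm. 2.46] -/
theorem IsPencilPlane.familyOrientation_of_smoothCompactification (hε : 0 < ε)
    (hJstd : ∀ x : punctured p, InPuncturedChartBall p ε x →
      ∀ (v : TangentSpace (𝓡 4) x) (c : EuclideanSpace ℝ (Fin 4)),
        inner ℝ (fderiv ℝ inversion (extChartAt (𝓡 4) p x.1 - extChartAt (𝓡 4) p p)
          (mfderiv (𝓡 4) 𝓘(ℝ, EuclideanSpace ℝ (Fin 4))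
            (fun z : punctured p => extChartAt (𝓡 4) p z.1) x (J x v))) c
        = stdSymplecticForm (fderiv ℝ inversion (extChartAt (𝓡 4) p x.1 - extChartAt (𝓡 4) p p)
          (mfderiv (𝓡 4) 𝓘(ℝ, EuclideanSpace ℝ (Fin 4))
            (fun z : punctured p => extChartAt (𝓡 4) p z.1) x v)) c)
    {Floc : ℂ → ℂ → punctured p} {b : ℂ} {δ : ℝ} (hδ : 0 < δ)
    (hmem : ∀ b' ∈ ball b δ, IsPencilPlane J (Floc b') b')
    (hsmooth : ContMDiffOn 𝓘(ℝ, ℂ × ℂ) (𝓡 4) ∞ (fun q : ℂ × ℂ => Floc q.1 q.2)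
      (ball b δ ×ˢ (univ : Set ℂ)))
    {rI : ℝ} (hrI : 0 < rI)
    (hU : ∀ b' ∈ ball b δ, ∀ η : ℂ, η ≠ 0 → ‖η‖ < rI →
      InPuncturedChartBall p ε (Floc b' η⁻¹) ∧ 1 < ‖(pencilCoord p (Floc b' η⁻¹)).1‖)
    (hSinf : ContDiffOn ℝ ∞ (famXW p Floc) (ball b δ ×ˢ ball 0 rI)) :
    ∃ Rₛ : ℝ, ∀ ξ : ℂ, Rₛ ≤ ‖ξ‖ → ∀ c v : ℂ,
      mfderiv 𝓘(ℝ, ℂ × ℂ) (𝓡 4) (fun q : ℂ × ℂ => Floc q.1 q.2) (b, ξ) (c, v) =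
        J (Floc b ξ) (mfderiv 𝓘(ℝ, ℂ × ℂ) (𝓡 4) (fun q : ℂ × ℂ => Floc q.1 q.2) (b, ξ) (1, 0)) →
      0 < c.im := by
  set Φ : ℂ × ℂ → punctured p := fun q => Floc q.1 q.2 with hΦ_def
  set L : ℂ → punctured p := Floc b with hL_def
  have hL : IsPencilPlane J L b := hmem b (mem_ball_self hδ)
  have hDom : IsOpen (ball b δ ×ˢ ball (0 : ℂ) rI) := isOpen_ball.prod isOpen_ball
  have hb0 : (b, (0 : ℂ)) ∈ ball b δ ×ˢ ball (0 : ℂ) rI := ⟨mem_ball_self hδ, mem_ball_self hrI⟩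
  set 𝔇 : ℂ × ℂ → (ℂ × ℂ →L[ℝ] ℂ × ℂ) := fderiv ℝ (famXW p Floc) with h𝔇
  have h𝔇c : ContinuousAt 𝔇 (b, 0) :=
    ((hSinf.continuousOn_fderiv_of_isOpen hDom (by exact_mod_cast le_top)).continuousAt
      (hDom.mem_nhds hb0))
  have hdiff : ∀ q ∈ ball b δ ×ˢ ball (0 : ℂ) rI, HasFDerivAt (famXW p Floc) (𝔇 q) q :=
    fun q hq => ((hSinf.differentiableOn (by simp)).differentiableAt (hDom.mem_nhds hq)).hasFDerivAt
  /- values of `𝔇 (b, 0)` -/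
  have hV1 : ∀ c : ℂ, 𝔇 (b, 0) (c, 0) = (0, c) := by
    intro c
    have h1 : HasFDerivAt (famXW p Floc ∘ fun b' : ℂ => (b', (0 : ℂ)))
        ((𝔇 (b, 0)).comp (ContinuousLinearMap.inl ℝ ℂ ℂ)) b :=
      HasFDerivAt.comp b (hdiff _ hb0) ((hasFDerivAt_id b).prodMk (hasFDerivAt_const (0 : ℂ) b))
    have h2 : HasFDerivAt (famXW p Floc ∘ fun b' : ℂ => (b', (0 : ℂ)))
        (ContinuousLinearMap.inr ℝ ℂ ℂ) b := by
      have : (famXW p Floc ∘ fun b' : ℂ => (b', (0 : ℂ))) = fun b' => ((0 : ℂ), b') :=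
        funext fun b' => famXW_zero Floc b'
      rw [this]
      exact (hasFDerivAt_const (0 : ℂ) b).prodMk (hasFDerivAt_id b)
    have h3 := congrArg (fun T : ℂ →L[ℝ] ℂ × ℂ => T c) (h1.unique h2)
    simpa using h3
  have hV2 : ∀ w : ℂ, (𝔇 (b, 0) (0, w)).1 = w := by
    intro w
    have h1 : HasFDerivAt (famXW p Floc ∘ fun η : ℂ => (b, η))
        ((𝔇 (b, 0)).comp (ContinuousLinearMap.inr ℝ ℂ ℂ)) 0 :=
      HasFDerivAt.comp (0 : ℂ) (hdiff _ hb0)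
        ((hasFDerivAt_const b (0 : ℂ)).prodMk (hasFDerivAt_id (0 : ℂ)))
    have h2 : HasFDerivAt (Prod.fst ∘ (famXW p Floc ∘ fun η : ℂ => (b, η)))
        ((ContinuousLinearMap.fst ℝ ℂ ℂ).comp
          ((𝔇 (b, 0)).comp (ContinuousLinearMap.inr ℝ ℂ ℂ))) 0 :=
      HasFDerivAt.comp (0 : ℂ) hasFDerivAt_fst h1
    have h3 : HasFDerivAt (Prod.fst ∘ (famXW p Floc ∘ fun η : ℂ => (b, η)))
        ((ContinuousLinearMap.smulRight (1 : ℂ →L[ℂ] ℂ) (1 : ℂ)).restrictScalars ℝ) 0 := by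
      have h := hL.hasDerivAt_inv_fst_zero
      have h' : HasDerivAt (capX p L) 1 0 := by rw [capX_eq]; exact h
      exact h'.hasFDerivAt.restrictScalars ℝ
    have h4 := congrArg (fun T : ℂ →L[ℝ] ℂ => T w) (h2.unique h3)
    simpa using h4
  /- the criterion threshold -/
  set K : ℝ := ‖𝔇 (b, 0)‖ + 1 with hK_def
  have hK1 : 1 ≤ K := by rw [hK_def]; linarith [norm_nonneg (𝔇 (b, 0))]
  have hKpos : 0 < 4 * K + 1 := by linarith
  obtain ⟨θ, hθ, hθP⟩ : ∃ θ : ℝ, 0 < θ ∧ ∀ q : ℂ × ℂ, dist q (b, 0) < θ →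
      ‖𝔇 q - 𝔇 (b, 0)‖ < (4 * K + 1)⁻¹ / 2 := by
    obtain ⟨θ, hθ, h⟩ := Metric.continuousAt_iff.1 h𝔇c ((4 * K + 1)⁻¹ / 2) (by positivity)
    exact ⟨θ, hθ, fun q hq => by have := h hq; rwa [dist_eq_norm] at this⟩
  refine ⟨max (max θ⁻¹ rI⁻¹) 1 + 1, fun ξ hξ c v hcv => ?_⟩
  /- basic facts about `ξ` and `η = ξ⁻¹` -/
  have hmax1 : θ⁻¹ ≤ max (max θ⁻¹ rI⁻¹) 1 := (le_max_left _ _).trans (le_max_left _ _)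
  have hmax2 : rI⁻¹ ≤ max (max θ⁻¹ rI⁻¹) 1 := (le_max_right _ _).trans (le_max_left _ _)
  have hmax3 : (1 : ℝ) ≤ max (max θ⁻¹ rI⁻¹) 1 := le_max_right _ _
  have hξ1 : 1 < ‖ξ‖ := by linarith
  have hξ0 : ξ ≠ 0 := fun h => by rw [h, norm_zero] at hξ1; linarith
  have hξpos : 0 < ‖ξ‖ := norm_pos_iff.2 hξ0
  set η : ℂ := ξ⁻¹ with hη
  have hη0 : η ≠ 0 := inv_ne_zero hξ0
  have hηpos : 0 < ‖η‖ := norm_pos_iff.2 hη0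
  have hηθ : ‖η‖ < θ := by
    rw [hη, norm_inv]
    exact inv_lt_of_inv_lt₀ hθ (by linarith)
  have hηr : ‖η‖ < rI := by
    rw [hη, norm_inv]
    exact inv_lt_of_inv_lt₀ hrI (by linarith)
  have hbη : (b, η) ∈ ball b δ ×ˢ ball (0 : ℂ) rI := ⟨mem_ball_self hδ, mem_ball_zero_iff.2 hηr⟩
  obtain ⟨hxball, hz1⟩ := hU b (mem_ball_self hδ) η hη0 hηr
  rw [hη, inv_inv] at hxball hz1
  have hX0 : capX p L η ≠ 0 := by
    rw [capX_of_ne_zero hη0, hη, inv_inv]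
    exact inv_ne_zero fun h => by
      have h' : (pencilCoord p (Floc b ξ)).1 = 0 := h
      rw [h', norm_zero] at hz1; linarith
  have hfam1 : (famXW p Floc (b, η)).1 = capX p L η := rfl
  /- the two derivative formulas for `Ψ = pencilCoord ∘ Φ` at `(b, ξ)` -/
  have hΦat : ContMDiffAt 𝓘(ℝ, ℂ × ℂ) (𝓡 4) ∞ Φ (b, ξ) :=
    hsmooth.contMDiffAt ((isOpen_ball.prod isOpen_univ).mem_nhds ⟨mem_ball_self hδ, mem_univ _⟩)
  have hxball' : InPuncturedChartBall p ε (Φ (b, ξ)) := hxball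
  set Pf : TangentSpace (𝓡 4) (Φ (b, ξ)) →L[ℝ] ℂ × ℂ :=
    (flatCx : EuclideanSpace ℝ (Fin 4) →L[ℝ] ℂ × ℂ).comp
      ((fderiv ℝ inversion (extChartAt (𝓡 4) p (Φ (b, ξ)).1 - extChartAt (𝓡 4) p p)).comp
        (mfderiv (𝓡 4) 𝓘(ℝ, EuclideanSpace ℝ (Fin 4))
          (fun z : punctured p => extChartAt (𝓡 4) p z.1) (Φ (b, ξ)))) with hPf
  set dΦ := mfderiv 𝓘(ℝ, ℂ × ℂ) (𝓡 4) Φ (b, ξ) with hdΦ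
  set Pfull : ℂ × ℂ →L[ℝ] ℂ × ℂ := Pf.comp dΦ with hPfull
  have hD1 : HasFDerivAt (fun q => pencilCoord p (Φ q)) Pfull (b, ξ) :=
    hasFDerivAt_pencilCoord_comp_family hΦat hxball'
  set dι : ℂ × ℂ →L[ℝ] ℂ × ℂ :=
    (ContinuousLinearMap.fst ℝ ℂ ℂ).prod ((-(ξ ^ 2)⁻¹ : ℂ) • ContinuousLinearMap.snd ℝ ℂ ℂ)
    with hdι
  have hι : HasFDerivAt (fun q : ℂ × ℂ => (q.1, q.2⁻¹)) dι (b, ξ) := by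
    refine hasFDerivAt_fst.prodMk ?_
    have hi : HasFDerivAt ((fun x : ℂ => x⁻¹) ∘ (Prod.snd : ℂ × ℂ → ℂ))
        ((ContinuousLinearMap.restrictScalars ℝ
          (ContinuousLinearMap.smulRight (1 : ℂ →L[ℂ] ℂ) (-(ξ ^ 2)⁻¹))).comp
          (ContinuousLinearMap.snd ℝ ℂ ℂ)) (b, ξ) :=
      ((hasFDerivAt_inv hξ0).restrictScalars ℝ).comp (b, ξ) hasFDerivAt_snd
    have hF : (ContinuousLinearMap.restrictScalars ℝ
          (ContinuousLinearMap.smulRight (1 : ℂ →L[ℂ] ℂ) (-(ξ ^ 2)⁻¹))).comp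
          (ContinuousLinearMap.snd ℝ ℂ ℂ) = (-(ξ ^ 2)⁻¹ : ℂ) • ContinuousLinearMap.snd ℝ ℂ ℂ := by
      ext v <;> simp [mul_comm]
    exact hF ▸ hi
  have hD2 : HasFDerivAt (fun q => pencilCoord p (Φ q))
      ((blowDownDeriv (capX p L η)).comp ((𝔇 (b, η)).comp dι)) (b, ξ) := by
    have hev : (fun q : ℂ × ℂ => pencilCoord p (Φ q)) =ᶠ[𝓝 (b, ξ)]
        fun q => blowDown (famXW p Floc (q.1, q.2⁻¹)) := by
      have : ∀ᶠ q : ℂ × ℂ in 𝓝 (b, ξ), q.2 ≠ 0 :=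
        continuous_snd.continuousAt.eventually (isOpen_compl_singleton.mem_nhds hξ0)
      filter_upwards [this] with q hq
      exact pencilCoord_eq_blowDown_famXW Floc hq
    refine HasFDerivAt.congr_of_eventuallyEq ?_ hev
    have hG := hasFDerivAt_blowDown (q := famXW p Floc (b, η)) (by rw [hfam1]; exact hX0)
    have hF := hdiff _ hbη
    exact hG.comp (b, ξ) (hF.comp (b, ξ) hι)
  have hEqD : Pfull = (blowDownDeriv (capX p L η)).comp ((𝔇 (b, η)).comp dι) := hD1.unique hD2
  /- the equation `T c + v ℓ = i T 1` -/
  have hPfJ : ∀ w : TangentSpace (𝓡 4) (Φ (b, ξ)), Pf (J _ w) = Complex.I • Pf w :=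
    fun w => flatCx_dpsi_J hJstd hxball' w
  have hEq1 : Pfull (c, v) = Complex.I • Pfull (1, 0) := by
    show Pf (dΦ (c, v)) = Complex.I • Pf (dΦ (1, 0))
    rw [show dΦ (c, v) = J _ (dΦ (1, 0)) from hcv]
    exact hPfJ _
  have hslice : ∀ v' : ℂ, Pfull (0, v') = v' • Pfull (0, 1) := by
    intro v'
    have hsd : DifferentiableAt ℂ (fun ξ' : ℂ => pencilCoord p (L ξ')) ξ := by
      have hO : IsOpen {ξ' : ℂ | InPuncturedChartBall p ε (L ξ')} := by
        have h1 : IsOpen {x : punctured p | InPuncturedChartBall p ε x} := by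
          have := (isCompact_compl_inPuncturedChartBall p hε).isClosed.isOpen_compl
          rwa [compl_compl] at this
        exact h1.preimage hL.continuous
      exact (differentiableOn_pencilCoord_comp hJstd hL.isJHolomorphic hL.contMDiff).differentiableAt
        (hO.mem_nhds hxball)
    have h1 : HasFDerivAt (fun ξ' : ℂ => pencilCoord p (L ξ'))
        ((fderiv ℂ (fun ξ' : ℂ => pencilCoord p (L ξ')) ξ).restrictScalars ℝ) ξ :=
      hsd.hasFDerivAt.restrictScalars ℝ
    have h2 : HasFDerivAt ((fun q => pencilCoord p (Φ q)) ∘ fun ξ' : ℂ => (b, ξ'))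
        (Pfull.comp (ContinuousLinearMap.inr ℝ ℂ ℂ)) ξ :=
      HasFDerivAt.comp ξ hD1 ((hasFDerivAt_const b ξ).prodMk (hasFDerivAt_id ξ))
    have h3 := h2.unique h1
    have hv : ∀ w : ℂ, Pfull (0, w) = (fderiv ℂ (fun ξ' : ℂ => pencilCoord p (L ξ')) ξ) w :=
      fun w => by
        have := congrArg (fun T : ℂ →L[ℝ] ℂ × ℂ => T w) h3
        simpa using this
    rw [hv, hv]
    conv_lhs => rw [show (v' : ℂ) = v' • (1 : ℂ) by simp]
    rw [ContinuousLinearMap.map_smul]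
  set T : ℂ →L[ℝ] ℂ × ℂ := Pfull.comp (ContinuousLinearMap.inl ℝ ℂ ℂ) with hT
  set ℓ : ℂ × ℂ := Pfull (0, 1) with hℓ
  have hEq2 : T c + v • ℓ = Complex.I • T 1 := by
    have hsplit : Pfull (c, v) = Pfull (c, 0) + Pfull (0, v) := by
      rw [← map_add]; simp
    simp only [hT, hℓ, ContinuousLinearMap.comp_apply, ContinuousLinearMap.inl_apply]
    rw [← hslice v, ← hsplit]
    exact hEq1
  apply im_pos_of_wirtinger_criterion T ℓ ?_ hEq2
  /- the criterion -/
  set X : ℂ := capX p L η with hX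
  have hTrepr : T = (blowDownDeriv X).comp ((𝔇 (b, η)).comp (ContinuousLinearMap.inl ℝ ℂ ℂ)) := by
    rw [hT, hEqD]
    ext1 c'
    simp [hdι]
  have hℓrepr : ℓ = blowDownDeriv X (𝔇 (b, η) (0, -η ^ 2)) := by
    rw [hℓ, hEqD]
    simp only [ContinuousLinearMap.comp_apply]
    congr 1
    simp [hdι, hη]
  rw [hTrepr, wirtPlus_blowDownDeriv_comp, wirtMinus_blowDownDeriv_comp, hℓrepr,
    nrmFun_blowDownDeriv, nrmFun_blowDownDeriv, norm_mul, norm_mul]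
  have hXfac : 0 < ‖(-(X ^ 2)⁻¹ : ℂ)‖ := by
    rw [norm_neg, norm_inv, norm_pow]
    exact inv_pos.2 (pow_pos (norm_pos_iff.2 hX0) 2)
  refine mul_lt_mul_of_pos_left ?_ hXfac
  -- rescale `m = 𝔇 (0, −η²) = ‖η‖² • μ`, `μ = 𝔇 (0, u)`, `‖u‖ = 1`
  set u : ℂ := -η ^ 2 / ((‖η‖ ^ 2 : ℝ) : ℂ) with hu
  have hη2 : (0 : ℝ) < ‖η‖ ^ 2 := by positivity
  have hu1 : ‖u‖ = 1 := by
    rw [hu, norm_div, norm_neg, norm_pow, Complex.norm_real, Real.norm_eq_abs,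
      abs_of_pos hη2, div_self hη2.ne']
  set μ : ℂ × ℂ := 𝔇 (b, η) (0, u) with hμ
  have hm : 𝔇 (b, η) (0, -η ^ 2) = ((‖η‖ ^ 2 : ℝ) : ℂ) • μ := by
    have h1 : ((0 : ℂ), -η ^ 2) = (‖η‖ ^ 2 : ℝ) • ((0 : ℂ), u) := by
      ext1
      · simp
      · simp only [Prod.smul_snd, Complex.real_smul, hu]
        have hne : ((‖η‖ ^ 2 : ℝ) : ℂ) ≠ 0 := by exact_mod_cast hη2.ne'
        field_simp
    rw [h1, ContinuousLinearMap.map_smul_of_tower, hμ, Complex.coe_smul]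
  set Ap := wirtPlus ((𝔇 (b, η)).comp (ContinuousLinearMap.inl ℝ ℂ ℂ)) with hAp
  set Am := wirtMinus ((𝔇 (b, η)).comp (ContinuousLinearMap.inl ℝ ℂ ℂ)) with hAm
  rw [hm]
  simp only [Prod.smul_fst, Prod.smul_snd, smul_eq_mul]
  have hresc : ∀ A : ℂ × ℂ, A.2 * (((‖η‖ ^ 2 : ℝ) : ℂ) * μ.1) - A.1 * (((‖η‖ ^ 2 : ℝ) : ℂ) * μ.2) =
      ((‖η‖ ^ 2 : ℝ) : ℂ) * (A.2 * μ.1 - A.1 * μ.2) := fun A => by ring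
  rw [hresc, hresc, norm_mul, norm_mul, Complex.norm_real, Real.norm_eq_abs, abs_of_pos hη2]
  refine mul_lt_mul_of_pos_left ?_ hη2
  -- the estimate
  set dd : ℝ := ‖𝔇 (b, η) - 𝔇 (b, 0)‖ with hdd
  have hdd_lt : dd < (4 * K + 1)⁻¹ / 2 := hθP (b, η) (by
    rw [Prod.dist_eq, dist_self, dist_zero_right]
    exact max_lt hθ hηθ)
  have hdd0 : 0 ≤ dd := norm_nonneg _
  have hdd1 : dd ≤ 1 := by
    have : (4 * K + 1)⁻¹ ≤ 1 := inv_le_one_of_one_le₀ (by linarith)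
    linarith
  -- values at `(b, 0)`
  have h10 : 𝔇 (b, 0) (1, 0) = (0, 1) := hV1 1
  have hI0 : 𝔇 (b, 0) (Complex.I, 0) = (0, Complex.I) := hV1 Complex.I
  have hnorm10 : ‖((1 : ℂ), (0 : ℂ))‖ = 1 := by simp [Prod.norm_def]
  have hnormI0 : ‖((Complex.I : ℂ), (0 : ℂ))‖ = 1 := by simp [Prod.norm_def]
  have hnorm0u : ‖((0 : ℂ), u)‖ = 1 := by simp [Prod.norm_def, hu1]
  have hdiff1 : ‖𝔇 (b, η) (1, 0) - (0, 1)‖ ≤ dd := by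
    rw [← h10, ← sub_apply]
    exact ((𝔇 (b, η) - 𝔇 (b, 0)).le_opNorm _).trans (by rw [hnorm10, mul_one])
  have hdiffI : ‖𝔇 (b, η) (Complex.I, 0) - (0, Complex.I)‖ ≤ dd := by
    rw [← hI0, ← sub_apply]
    exact ((𝔇 (b, η) - 𝔇 (b, 0)).le_opNorm _).trans (by rw [hnormI0, mul_one])
  have hAp_est : ‖Ap - (0, 1)‖ ≤ dd := by
    have hrepr : Ap - (0, 1) = (2⁻¹ : ℂ) • ((𝔇 (b, η) (1, 0) - (0, 1)) -
        Complex.I • (𝔇 (b, η) (Complex.I, 0) - (0, Complex.I))) := by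
      simp only [hAp, wirtPlus, ContinuousLinearMap.comp_apply, ContinuousLinearMap.inl_apply]
      ext1
      · simp
      · simp; ring_nf; rw [Complex.I_sq]; ring
    rw [hrepr, norm_smul]
    have h2 : ‖(𝔇 (b, η) (1, 0) - (0, 1)) - Complex.I • (𝔇 (b, η) (Complex.I, 0) - (0, Complex.I))‖
        ≤ dd + dd := (norm_sub_le _ _).trans (add_le_add hdiff1 (by rw [norm_smul, Complex.norm_I, one_mul]; exact hdiffI))
    have : ‖(2⁻¹ : ℂ)‖ = 2⁻¹ := by simp
    rw [this]
    linarith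
  have hAm_est : ‖Am‖ ≤ dd := by
    have hrepr : Am = (2⁻¹ : ℂ) • ((𝔇 (b, η) (1, 0) - (0, 1)) +
        Complex.I • (𝔇 (b, η) (Complex.I, 0) - (0, Complex.I))) := by
      simp only [hAm, wirtMinus, ContinuousLinearMap.comp_apply, ContinuousLinearMap.inl_apply]
      ext1
      · simp
      · simp; ring_nf; rw [Complex.I_sq]; ring
    rw [hrepr, norm_smul]
    have h2 : ‖(𝔇 (b, η) (1, 0) - (0, 1)) + Complex.I • (𝔇 (b, η) (Complex.I, 0) - (0, Complex.I))‖
        ≤ dd + dd := (norm_add_le _ _).trans (add_le_add hdiff1 (by rw [norm_smul, Complex.norm_I, one_mul]; exact hdiffI))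
    have : ‖(2⁻¹ : ℂ)‖ = 2⁻¹ := by simp
    rw [this]
    linarith
  have hμ_est : ‖μ - (u, (𝔇 (b, 0) (0, u)).2)‖ ≤ dd := by
    have h0u : 𝔇 (b, 0) (0, u) = (u, (𝔇 (b, 0) (0, u)).2) := by
      ext1
      · exact hV2 u
      · rfl
    rw [← h0u, hμ, ← sub_apply]
    exact ((𝔇 (b, η) - 𝔇 (b, 0)).le_opNorm _).trans (by rw [hnorm0u, mul_one])
  have hμK : ‖μ‖ ≤ K := by
    have h1 : ‖μ‖ ≤ ‖𝔇 (b, η)‖ := by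
      rw [hμ]; exact ((𝔇 (b, η)).le_opNorm _).trans (by rw [hnorm0u, mul_one])
    have h2 : ‖𝔇 (b, η)‖ ≤ ‖𝔇 (b, 0)‖ + dd := by
      rw [hdd]; exact norm_le_insert' _ _
    rw [hK_def]; linarith
  have hdK : dd * (4 * K + 1) < 1 := by
    have := mul_lt_mul_of_pos_right hdd_lt hKpos
    rw [div_mul_eq_mul_div, inv_mul_cancel₀ hKpos.ne'] at this
    linarith
  exact criterion_estimate hAp_est hAm_est hμ_est hu1 hμK hdK

end Orientation

end Literature.Geometry.Symplectic
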